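import Mathlib
import HarnessLib
import Summits.HubbardSuperconductivity.HubbardSuperconductivity.Theorems.ComplexGFFStiffnessHypACumulantIotaTuning
import Summits.HubbardSuperconductivity.HubbardSuperconductivity.Theorems.ComplexGFFStiffnessHypACumulantFlowStartQ
import Literature.MathematicalPhysics.StatisticalMechanics.TunedFlowRepresentation
import Literature.MathematicalPhysics.StatisticalMechanics.TuningMapOfHamiltonian

/-!
# Crux `HypACumulant`, line `gnv` — the partition function along the TUNED flow:
# `pertZ n 𝒦 = c · (1 + ∫ K_N(Λ) dμ_{N+1})`, `|∫ K_N(Λ) dμ_{N+1}| ≤ ε η^N A_𝒫/A`, hence `pertZ n 𝒦 ≠ 0`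

Route `route-HubbardSuperconductivity-ComplexGFFStiffness`, crux item stmt-HubbardSuperconductivity-19154,
research stub `stub_gnvOfFrd : TorusFRD 4 → GNV` (R-list entry R6c: flow identity + last scale).
Composition of

* `…HypACumulantIotaTuning.exists_tuned_initial_iota_of_torusFRD` — [ABKM19] Lemma 12.6 on the
  `ι`-symmetric class with the tuning map `hamTuningMap ρ` (`TuningMapOfHamiltonian`): a tuned
  trajectory started from `(ℋ⋆, K̂_0(𝒦, ℋ⋆))`, `ℋ⋆` with REAL quadratic part, Gaussian `μ^{(q(ℋ⋆))}`;
* `Literature/…/TunedFlowRepresentation.norm_integral_flowStart_sub_one_le_of_isTunedQ` — along such a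
  trajectory `∫ (e^{−ℋ⋆} ∘_0 K̂_0)(Λ) dμ^{(q)} = 1 + ∫ K_N(Λ) dμ_{N+1}` with `|∫ K_N(Λ)| ≤ εη^N A⁻¹ A_𝒫`;
* `…HypACumulantFlowStartQ.exists_pertZ_eq_mul_integral_flowStart_q` — `pertZ n 𝒦 = c · ∫ (e^{−ℋ⋆} ∘_0 K̂_0)(Λ) dμ^{(q(ℋ⋆))}`, `c ≠ 0`:

* **`exists_iota_tuned_representation`** (general `d`) — under the hypotheses of Lemma 12.6 for the
  torus data (package form) plus `4p ≤ 2^{d+2}` and `2d²ρ/𝔥_0² ≤ T₀`: there is an `ι`-Hamiltonian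
  `ℋ⋆`, `‖ℋ⋆‖ ≤ ρ`, with `‖∫ (e^{−ℋ⋆} ∘_0 K̂_0(𝒦,ℋ⋆))(Λ) d(tailMeasure 𝒞_{𝟙+q(ℋ⋆)} N N) − 1‖ ≤ εη^N A⁻¹A_𝒫`;
* **`pertZ_ne_zero_of_representation`** (`d = 4`) — `pertZ n 𝒦 ≠ 0` from such an `ℋ⋆` and the
  `TorusFRD` clauses at `A = 𝟙`, `A = 𝟙 + q(ℋ⋆)`.

Honest scope: the `N`-uniform choice of the parameters (the quantifier structure of `GNV`) is not
here.  All proved; no `sorry`.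

## References
* S. Adams, S. Buchholz, R. Kotecký, S. Müller, arXiv:1910.13564, Ch. 4.2–4.4, Ch. 12, Lemma 12.6
  [AdamsBuchholzKoteckyMuller2019].
-/

noncomputable section

-- `Summit.<Summit>.<Problem>`: single-conjunct summit, the duplicate component is mandated (D-0017).
set_option linter.dupNamespace false

namespace Summit.HubbardSuperconductivity.HubbardSuperconductivity.Theorems.ComplexGFF

open scoped BigOperators ComplexConjugate
open Real Set Finset MeasureTheory
open Literature.MathematicalPhysics.StatisticalMechanics.GradientRG
open Literature.MathematicalPhysics.StatisticalMechanics.GradientFRD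
  (fourierCoeff cExt cExt_of_mem IsElliptic IsUnitSymm InShell iterDiff supNorm conv ellOp isElliptic_one)
open Literature.MathematicalPhysics.StatisticalMechanics.TorusPolymer
  (IsPolymer numBlocks blockOf boxCorner isPolymer_blockOf isConn_blockOf pcirc)
open Literature.Barriers.CriticalPhenomena.LongRangePhi4.Polymer (IsConn components)
open Literature.MathematicalPhysics.QuantumFieldTheory
open Literature.Dynamics.Hyperbolic

variable {d M : ℕ} [NeZero M]

section Package

variable {L N Mord R n ñ : ℕ} {θbar lam μ δ₁ δ₀ A𝒫 : ℝ}
    {𝒞 : Matrix (Fin d) (Fin d) ℝ → ℕ → (Fin d → ZMod M) → ℝ} {Mc : ℕ → ℝ}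
    {Cα : (Fin d → ℕ) → ℕ → ℝ} {c C : ℝ} {Cℓ : ℕ → ℝ}

set_option maxHeartbeats 1600000 in
/-- **The tuned representation on the `ι`-symmetric class** (module docstring): there is `ℋ⋆` with
`IsIotaHam ℋ⋆`, `‖ℋ⋆‖ ≤ ρ` and
`‖∫ (e^{−ℋ⋆} ∘_0 K̂_0(𝒦,ℋ⋆))(Λ,φ) (tailMeasure 𝒞_{𝟙+q(ℋ⋆)} N N)(dφ) − 1‖ ≤ ε η^N A⁻¹ A_𝒫`,
`q(ℋ⋆) = hamQuadForm ℋ⋆`. -/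
theorem exists_iota_tuned_representation {h : ℝ} [Fact (0 < h)] [Fact (0 < L)]
    (hd : 3 ≤ d) (hMord : 1 ≤ Mord) (hMR : Mord ≤ R) (hLodd : Odd L) (hL : 2 ^ (d + 3) + 16 * R ≤ L)
    (hR2 : 2 ≤ R) (hM : M = L ^ N)
    (hθbar : 0 < θbar) (hlam : 0 < lam) (hn : 2 * Mord ≤ n) (hn2 : 2 ≤ n) (hnñ : n ≤ ñ)
    (hc : 0 < c) (hC1 : 0 ≤ Cℓ 1)
    (hallA : ∀ A : Matrix (Fin d) (Fin d) ℝ, IsElliptic (1 / 2 : ℝ) 2 A →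
        (∀ k, 1 ≤ k → k ≤ N + 1 →
          ∑ x : Fin d → ZMod M, 𝒞 A k x = 0 ∧ ∀ x, 𝒞 A k (-x) = 𝒞 A k x) ∧
        (∀ k, 1 ≤ k → k ≤ N + 1 → ∀ φ : (Fin d → ZMod M) → ℝ, ∑ x, φ x = 0 →
          0 ≤ ∑ x, ∑ y, φ x * 𝒞 A k (x - y) * φ y) ∧
        (∀ φ : (Fin d → ZMod M) → ℝ, ∑ x, φ x = 0 →
          ellOp A (conv (fun x => ∑ k ∈ Finset.Icc 1 (N + 1), 𝒞 A k x) φ) = φ) ∧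
        (∀ k, 1 ≤ k → k ≤ N → Mc k ≤ 0 ∧
          ∀ x : Fin d → ZMod M, ((L : ℝ) ^ k) / 2 ≤ (supNorm x : ℝ) →
            𝒞 A k x = Mc k) ∧
        (∀ k, 1 ≤ k → k ≤ N + 1 → ∀ B : Matrix (Fin d) (Fin d) ℝ, IsUnitSymm B →
          (∃ ε : ℝ, 0 < ε ∧ ∀ x : Fin d → ZMod M,
            ContDiffOn ℝ ⊤ (fun s : ℝ => 𝒞 (A + s • B) k x) (Set.Ioo (-ε) ε)) ∧
          ∀ α : Fin d → ℕ, ∑ i, α i ≤ n → ∀ ℓ : ℕ, ∀ x : Fin d → ZMod M,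
            abs (iteratedDeriv ℓ (fun s : ℝ => iterDiff α (𝒞 (A + s • B) k) x) 0)
              ≤ Cα α ℓ / (L : ℝ) ^ ((k - 1) * (d - 2 + ∑ i, α i))) ∧
        (∀ k, 1 ≤ k → k ≤ N + 1 → ∀ j : ℕ, ∀ κ : Fin d → ZMod M, κ ≠ 0 → InShell L j κ →
          (j < k →
            c / (L : ℝ) ^ (2 * (d + ñ) + 1) * (L : ℝ) ^ (2 * j)
                / (L : ℝ) ^ ((k - j) * (d - 1 + n)) ≤ (fourierCoeff (𝒞 A k) κ).re ∧
            ‖fourierCoeff (𝒞 A k) κ‖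
              ≤ C * (L : ℝ) ^ (2 * (d + ñ) + 1) * (L : ℝ) ^ (2 * j)
                  / (L : ℝ) ^ ((k - j) * (d - 1 + n))) ∧
          (k ≤ j →
            c / (L : ℝ) ^ (2 * (d + ñ) + 1) * (L : ℝ) ^ (2 * k)
                ≤ (fourierCoeff (𝒞 A k) κ).re ∧
            ‖fourierCoeff (𝒞 A k) κ‖ ≤ C * (L : ℝ) ^ (2 * k)) ∧
          ∀ B : Matrix (Fin d) (Fin d) ℝ, IsUnitSymm B → ∀ ℓ : ℕ, 1 ≤ ℓ →
            (j < k →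
              ‖iteratedDeriv ℓ (fun s : ℝ => fourierCoeff (𝒞 (A + s • B) k) κ) 0‖
                ≤ Cℓ ℓ * (L : ℝ) ^ (2 * (d + ñ) + 1) * (L : ℝ) ^ (2 * j)
                    / (L : ℝ) ^ ((k - j) * (d - 1 + ñ))) ∧
            (k ≤ j →
              ‖iteratedDeriv ℓ (fun s : ℝ => fourierCoeff (𝒞 (A + s • B) k) κ) 0‖
                ≤ Cℓ ℓ * (L : ℝ) ^ (2 * k))))
    (hB : AbkmWeightBounds L N Mord R n θbar lam μ δ₁ δ₀ A𝒫 (fun j => 𝒞 1 j)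
      (abkmWeightData L N Mord R θbar (schedDelta δ₀ δ₁ N) fun j => 𝒞 1 j))
    {pT r₀ : ℕ} (hp : d / 2 + 2 ≤ pT) (hpM : pT + d ≤ Mord) (hr₀ : 3 ≤ r₀)
    (hδ₀ : 0 < δ₀) (hδ₁ : 0 < δ₁) (hh0 : hZeroSq d R δ₀ δ₁ ≤ h ^ 2)
    (hh2 : secondDiffConst (fun θ' => Cα θ' 0) ≤ h ^ 2)
    -- the tuning ball
    {θ : ℝ} (hθ0 : 0 ≤ θ) (hθ : θ < θbar)
    {T₀ : ℝ} (hT₀ : T₀ ≤ 1 / 2) (hKT₀ : shellRatioConst c (Cℓ 1) (L : ℝ) d ñ * T₀ ≤ Real.log (1 + θ))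
    {A𝒫' : ℝ} (hA𝒫' : weightIntConstRho θbar θ (traceConst d Mord R lam (derivSum d n fun θ' _ => Cα θ' 0)) = A𝒫')
    -- the side conditions of Theorem 6.8 (`RGStepABKMQ`), at `A_𝒫' = A_𝒫(θ)`
    {A : ℝ} (hA1 : 1 ≤ A) (hA𝒫A : A𝒫' ≤ A)
    (hsmall : (2 : ℝ) ^ (L ^ d) * (A𝒫' * A ^ (-(1 - (1 + 1 / ((2 * (2 ^ d + 1) + 6 : ℝ) ^ d))⁻¹) : ℝ)) ≤ 1)
    {r : ℝ} (hr0 : 0 ≤ r) (hr : r ≤ 1 / 64)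
    (hv : vABKM d R A A𝒫' r ≤ 1 / 64) (hωA : omegaABKM d R A A𝒫' r * A ^ 2 ≤ 1)
    (hc3A : (kappaABKM d R A A𝒫' r) ^ (L ^ d) * ((2 * (2 * (kappaABKM d R A A𝒫' r) * max 1 A𝒫')) ^ ((2 ^ (d + 1) + 2) ^ d * L ^ d) * (4 : ℝ) ^ ((2 ^ (d + 1) + 2) ^ d * L ^ d)) ≤ A ^ ((1 + 1 / ((2 * (2 ^ d + 1) + 6 : ℝ) ^ d)) - 1 : ℝ))
    (hc2A : (kappaABKM d R A A𝒫' r) ^ (L ^ d) * ((2 * (kappaABKM d R A A𝒫' r) * max 1 A𝒫') ^ ((2 ^ (d + 1) + 2) ^ d * L ^ d) * (2 : ℝ) ^ ((2 ^ (d + 1) + 2) ^ d * L ^ d)) ≤ A ^ ((1 + 1 / ((2 * (2 ^ d + 1) + 6 : ℝ) ^ d)) - 1 : ℝ))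
    -- the contraction regime of Ch. 12
    {η κ ε ρ : ℝ} (hη : 0 < η) (hη1 : η ≤ 1)
    (hκ₁ : (3 / 4 : ℝ) * (η + (L : ℝ) ^ d * (pi2BoundConst d (((2 * R + 2 : ℕ) : ℝ) + ((d / 2 + 1 : ℕ) : ℝ)) * (A𝒫' * A⁻¹))) ≤ κ)
    (hκ₂ : sigmaABKM d L R A A𝒫' r ≤ κ * η) (hκ : κ < 1)
    (hε : 0 ≤ ε) (hεr : ε ≤ r) (hερ : ε ≤ ρ) (hρ16 : ρ ≤ 1 / 16)
    -- the initial perturbation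
    {𝒦 : (Fin d → ℝ) → ℂ} {ρ𝒦 : ℝ} (h𝒦 : ContDiff ℝ r₀ 𝒦)
    (h𝒦b : ∀ s, s ≤ r₀ → ∀ z : Fin d → ℝ, ‖iteratedFDeriv ℝ s 𝒦 z‖ ≤ ρ𝒦 * Real.exp ((∑ i, z i ^ 2) / 4))
    (h𝒦small : (Real.exp (1 / 4) + 2 * Real.exp (3 / 8)) *
      (ρ𝒦 * Real.exp (fieldWt h (L : ℝ) d 0 / (L : ℝ) ^ 0)) * A ≤ 1 / 2)
    (h𝒦ε : Real.exp (1 / 4) * (ρ𝒦 * Real.exp (fieldWt h (L : ℝ) d 0 / (L : ℝ) ^ 0)) * A ≤ ε)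
    (h𝒦ι : ∀ z, 𝒦 (-z) = conj (𝒦 z))
    -- the tuning map
    -- the two extra conditions of the flow identity / tuning map
    (hp4 : 4 * pT ≤ 2 ^ (d + 2))
    (hqT₀ : 2 * (d : ℝ) ^ 2 / (((L ^ (d * 0) : ℕ) : ℝ) * (fieldWt h (L : ℝ) d 0 / (L : ℝ) ^ 0) ^ 2) * ρ ≤ T₀) :
    ∃ x₀ : HamSpace ℂ d (fieldWt h (L : ℝ) d 0) ((L : ℝ) ^ 0) (L ^ (d * 0)), IsIotaHam (HamSpace.toHam x₀) ∧ ‖x₀‖ ≤ ρ ∧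
      ‖(∫ φ, pcirc 1 (fun V => expNegH (HamSpace.toHam x₀) V φ)
            (fun U => initKH 𝒦 (HamSpace.toHam x₀) U φ) Finset.univ
          ∂(tailMeasure (fun j => 𝒞 ((1 : Matrix (Fin d) (Fin d) ℝ) + hamQuadForm (HamSpace.toHam x₀)) j) N N)) - 1‖
        ≤ ε * η ^ N * A⁻¹ * A𝒫' := by
  have hh : 0 < h := Fact.out
  have hd2 : 2 ≤ d := by omega
  have hA : 0 < A := by linarith
  have hρ0 : 0 ≤ ρ := hε.trans hερ
  have hA𝒫0 : 0 ≤ A𝒫' := by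
    rw [← hA𝒫']
    exact zero_le_one.trans (one_le_weightIntConstRho hθbar hθ0 hθ
      (traceConst_nonneg d Mord R hlam.le (derivSum_nonneg d n _)))
  -- the tuning map `q = hamTuningMap ρ`
  set qmap : HamSpace ℂ d (fieldWt h (L : ℝ) d 0) ((L : ℝ) ^ 0) (L ^ (d * 0)) → Matrix (Fin d) (Fin d) ℝ :=
    hamTuningMap ρ with hqmap
  have hqsymm : ∀ x, (qmap x).IsSymm := fun x => hamTuningMap_isSymm ρ x
  have hqT : ∀ x, ∑ i, ∑ j, |qmap x i j| ≤ T₀ := fun x => (entrySum_hamTuningMap_le hρ0 x).trans hqT₀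
  have hLq : (0 : ℝ) ≤ 2 * (d : ℝ) ^ 2 / (((L ^ (d * 0) : ℕ) : ℝ) * (fieldWt h (L : ℝ) d 0 / (L : ℝ) ^ 0) ^ 2) := by
    positivity
  have hqlip : ∀ x x' : HamSpace ℂ d (fieldWt h (L : ℝ) d 0) ((L : ℝ) ^ 0) (L ^ (d * 0)), ‖x‖ ≤ ρ → ‖x'‖ ≤ ρ →
      ∑ i, ∑ j, |(qmap x - qmap x') i j| ≤
        2 * (d : ℝ) ^ 2 / (((L ^ (d * 0) : ℕ) : ℝ) * (fieldWt h (L : ℝ) d 0 / (L : ℝ) ^ 0) ^ 2) * ‖x - x'‖ :=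
    fun x x' hx hx' => entrySum_hamTuningMap_sub_le x x' hx hx'
  obtain ⟨x₀, hι, hx₀ρ, x, htraj, htube, hx0⟩ := exists_tuned_initial_iota_of_torusFRD (h := h) hd hMord hMR hLodd hL
    hR2 hM hθbar hlam hn hn2 hnñ hc hC1 hallA hB hp hpM hr₀ hδ₀ hδ₁ hh0 hh2 hθ0 hθ hT₀ hKT₀ hA𝒫' hA1 hA𝒫A hsmall
    hr0 hr hv hωA hc3A hc2A hη hη1 hκ₁ hκ₂ hκ hε hεr hερ hρ16 h𝒦 h𝒦b h𝒦small h𝒦ε h𝒦ι qmap hqsymm hqT hLq hqlip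
  refine ⟨x₀, hι, hx₀ρ, ?_⟩
  have hq0 : qmap x₀ = hamQuadForm (HamSpace.toHam x₀) := hamTuningMap_of_le hx₀ρ
  -- the tuned kernel family and its properties
  set q := qmap x₀ with hqdef
  set 𝒞s : ℕ → (Fin d → ZMod M) → ℝ := fun j => 𝒞 ((1 : Matrix (Fin d) (Fin d) ℝ) + q) j with h𝒞s
  have hell : IsElliptic (1 / 2 : ℝ) 2 ((1 : Matrix (Fin d) (Fin d) ℝ) + q) :=
    isElliptic_one_add_of_entrySum_le (hqsymm x₀) ((hqT x₀).trans hT₀)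
  obtain ⟨hA0, -, -, hAiii, -⟩ := hallA _ hell
  have hS : ∀ k, k ≤ N → StepKernelBounds (abkmWeightData L N Mord R θbar (schedDelta δ₀ δ₁ N) fun j => 𝒞 1 j) L k
      A𝒫' (secondDiffConst fun θ' => Cα θ' 0) (𝒞s (k + 1)) := by
    intro k hk
    have h := stepKernelBounds_one_add_of_torusFRD hd hMord hMR hLodd hL hθbar hlam hn hn2 hnñ hc hC1 hallA hB
      (k := k) (by omega) hθ0 hθ hT₀ hKT₀ (hqsymm x₀) (hqT x₀)
    rw [hA𝒫'] at h
    exact h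
  have h0s : ∀ k, k + 1 ≤ N → ∑ z, 𝒞s (k + 1) z = 0 ∧ ∀ z, 𝒞s (k + 1) (-z) = 𝒞s (k + 1) z :=
    fun k hk => hA0 (k + 1) (by omega) (by omega)
  have hranges : ∀ k, k + 1 ≤ N → ∃ m : ℝ, m ≤ 0 ∧
      ∀ z : Fin d → ZMod M, ((L : ℝ) ^ (k + 1)) / 2 ≤ (supNorm z : ℝ) → 𝒞s (k + 1) z = m := by
    intro k hk
    obtain ⟨hMc, hfr⟩ := hAiii (k + 1) (by omega) hk
    exact ⟨Mc (k + 1), hMc, hfr⟩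
  -- the initial activity is admissible
  have hH8 : hamNorm (fieldWt h (L : ℝ) d 0) ((L : ℝ) ^ 0) (L ^ (d * 0)) (HamSpace.toHam x₀) ≤ 1 / 8 := by
    rw [← HamSpace.norm_def]; linarith
  have hsm1 : Real.exp (1 / 4) * (ρ𝒦 * Real.exp (fieldWt h (L : ℝ) d 0 / (L : ℝ) ^ 0)) * A ≤ 1 := by linarith
  have hmem₀ := restrictConn_initKH_mem_activitySpace (N := N) (R := R) (n := n) (p := pT) (r₀ := r₀) (θbar := θbar)
    (lam := lam) (μ := μ) (δ₁ := δ₁) (δ₀ := δ₀) (A𝒫 := A𝒫) hd2 hLodd hM (by omega) (by omega) hB hδ₀ hδ₁ hh hh0 hA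
    h𝒦 h𝒦b hH8 hsm1
  -- `B_k` acts as `opB`
  have hBeq : ∀ k, k < N → ∀ y : activitySpace (abkmNormParams L N Mord R pT r₀ h θbar A (schedDelta δ₀ δ₁ N)
      fun j => 𝒞 1 j) k,
      HamSpace.toHam (rgBT hd hMord hMR hLodd hL hM hθbar hlam hn hn2 hnñ hc hC1 hallA hB pT r₀ hr₀ A hθ0 hθ hT₀ hKT₀ q k y) =
        opB (abkmStepData L R k 𝒞s) (y : Finset (Fin d → ZMod M) → ((Fin d → ZMod M) → ℝ) → ℂ) := by
    intro k hk y
    rw [rgBT_of_mem hd hMord hMR hLodd hL hM hθbar hlam hn hn2 hnñ hc hC1 hallA hB pT r₀ hr₀ A hθ0 hθ hT₀ hKT₀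
      (hqsymm x₀) (hqT x₀)]
    unfold rgBQ
    rw [dif_pos (by omega : k + 1 ≤ N)]
    simp only [AddMonoidHom.coe_comp, Function.comp_apply, LinearMap.toAddMonoidHom_coe,
      LinearEquiv.coe_toLinearMap, HamSpace.toHam_ofHam, opBHomQ_apply]
    rfl
  have hmain := norm_integral_flowStart_sub_one_le_of_isTunedQ (p := pT) (r₀ := r₀) hd hLodd hL hR2 hM hp hp4 hpM hMR hr₀ hB
    hδ₀ hδ₁ hh0 hS h0s hranges hh2 hA𝒫0 hA1 hA𝒫A hsmall hr hv hωA hc3A hc2A hη hη1 hε hεr hmem₀ hBeq htraj htube hx0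
  rw [← hq0]
  exact hmain

end Package

/-! ## `d = 4`: non-vanishing of the partition function -/

variable {n : ℕ} [NeZero n]

/-- **`pertZ n 𝒦 ≠ 0` from a tuned representation**: if `ℋ` has real quadratic coefficients, the
kernel families at `A = 𝟙` and `A = 𝟙 + q(ℋ)` satisfy the `TorusFRD` clauses (o), (i), (ii), `𝒦` is
continuous, and `‖∫ (e^{−ℋ} ∘_0 K̂_0(𝒦,ℋ))(Λ) d(tailMeasure 𝒞q N N) − 1‖ < 1`, then `pertZ n 𝒦 ≠ 0`
(`…FlowStartQ`: `pertZ = c · ∫ …`, `c ≠ 0`). -/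
theorem pertZ_ne_zero_of_representation {N : ℕ} {𝒞₁ 𝒞q : ℕ → (Fin 4 → ZMod n) → ℝ}
    {H : RelevantHamiltonian ℂ 4}
    (hq : ∀ p : quadIndex 4, ((H (Sum.inr (Sum.inr p))).re : ℂ) = H (Sum.inr (Sum.inr p)))
    (h0₁ : ∀ k ∈ Finset.Icc 1 (N + 1), ∑ x, 𝒞₁ k x = 0)
    (heven₁ : ∀ k ∈ Finset.Icc 1 (N + 1), ∀ x, 𝒞₁ k (-x) = 𝒞₁ k x)
    (hpos₁ : ∀ k ∈ Finset.Icc 1 (N + 1), ∀ φ : (Fin 4 → ZMod n) → ℝ, ∑ x, φ x = 0 →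
      0 ≤ ∑ x, ∑ y, φ x * 𝒞₁ k (x - y) * φ y)
    (hinv₁ : ∀ φ : (Fin 4 → ZMod n) → ℝ, ∑ x, φ x = 0 →
      ellOp (1 : Matrix (Fin 4) (Fin 4) ℝ) (conv (fun x => ∑ k ∈ Finset.Icc 1 (N + 1), 𝒞₁ k x) φ) = φ)
    (h0q : ∀ k ∈ Finset.Icc 1 (N + 1), ∑ x, 𝒞q k x = 0)
    (hevenq : ∀ k ∈ Finset.Icc 1 (N + 1), ∀ x, 𝒞q k (-x) = 𝒞q k x)
    (hposq : ∀ k ∈ Finset.Icc 1 (N + 1), ∀ φ : (Fin 4 → ZMod n) → ℝ, ∑ x, φ x = 0 →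
      0 ≤ ∑ x, ∑ y, φ x * 𝒞q k (x - y) * φ y)
    (hinvq : ∀ φ : (Fin 4 → ZMod n) → ℝ, ∑ x, φ x = 0 →
      ellOp ((1 : Matrix (Fin 4) (Fin 4) ℝ) + hamQuadForm H)
        (conv (fun x => ∑ k ∈ Finset.Icc 1 (N + 1), 𝒞q k x) φ) = φ)
    {K : (Fin 4 → ℝ) → ℂ} (hK : Continuous K)
    (hbound : ‖(∫ φ, pcirc 1 (fun V => expNegH H V φ) (fun U => initKH K H U φ) Finset.univ
        ∂(tailMeasure 𝒞q N N)) - 1‖ < 1) :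
    pertZ n K ≠ 0 := by
  obtain ⟨c₀, hc₀, hZ⟩ := exists_pertZ_eq_mul_integral_flowStart_q (n := n) hq h0₁ heven₁ hpos₁ hinv₁ h0q hevenq hposq
    hinvq hK
  rw [hZ]
  refine mul_ne_zero hc₀ fun h0 => ?_
  rw [h0, zero_sub, norm_neg, norm_one] at hbound
  exact lt_irrefl _ hbound

end Summit.HubbardSuperconductivity.HubbardSuperconductivity.Theorems.ComplexGFF

end
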